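import Mathlib
import Literature.NumberTheory.LFunctions.Zhang2022.Section15CEq1522Assembly
import Literature.NumberTheory.LFunctions.Zhang2022.AppendixBLemma151Circles
import Literature.NumberTheory.LFunctions.Zhang2022.AppendixBLemma151ResBeta
import Literature.NumberTheory.LFunctions.Zhang2022.AppendixBLemma151ResBetaValue
import Literature.NumberTheory.LFunctions.Zhang2022.AppendixBLemma151Mu3Value
import Literature.NumberTheory.LFunctions.Zhang2022.AppendixBLemma151Mu1Circles
import Literature.NumberTheory.LFunctions.Zhang2022.AppendixBLemma151Mu1Value
import Literature.NumberTheory.LFunctions.Zhang2022.AppendixBPerronGeneric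
import Literature.NumberTheory.LFunctions.Zhang2022.AppendixBTailB3Fubini
import HarnessLib

/-!
# Zhang (2022) §15 (15.22): the leaf `h15_22` (E-reading `Eq15_22E e1ppD c′ inputs15ABchi`) REDUCED to
# the three Appendix-B line-to-circle contour bounds and the (B.3) inner-integral evaluation

Topic `Literature/NumberTheory/LFunctions/Zhang2022` (Landau–Siegel audit tree; verdict-neutral).
Y. Zhang, *Discrete mean estimates and the Landau–Siegel zero*, arXiv:2211.02515v1 (2022)
[Zhang2022LandauSiegel] — **an unrefereed manuscript under adjudication; nothing here asserts or denies
its Theorems 1–2.** ZHANG-L discharge lane (WP15), leaf `h15_22` [Z22 §15 p. 87, (15.22), tex L4306] in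
the reading of record (RT-05 / R-28: `𝔢ⱼ := frakeE e1ppD j`; skeleton v28 binder
`∀ c' ≥ c₁, Typed.Section15C.Eq15_22E e1ppD c' Typed.Section15C.inputs15ABchi`).

`Section15CEq1522Assembly.eq15_22D_of_appB_legs` assembled the leaf down to the four one-variable
Appendix-B evaluations `StepB_mu2R`, `StepB_mu3R`, `StepB_u012R`, `StepB_u015bR` (plus `StepB_u015aR`, a
theorem). Since then every input of the three `ϰ_μ`-evaluations EXCEPT the move of the line of
integration `Re s = 1` to the circle `|s| = 5α` has become a theorem of the tree:

* `μ = 2` (App. B p. 107, `Z22:§B.u009`–`u011`): Perron `Typed.AppendixB.stepB_u009_holds`, two-circle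
  split `Skeleton.intB2_circle_split`, residue at `0` `Skeleton.circleIntegral_intB2_zero_sub_resZero2_le`
  (rate `α`, lifted here to `α₁`), its value `Skeleton.stepB_u011a_holds`, the `β₇`-residue value
  `Skeleton.stepB_u011bR_holds`, composed by `Skeleton.stepB_mu2_alpha1_of`;
* `μ = 3`: `Skeleton.stepB_mu3R_of_perron_shift` with the Perron identity `Skeleton.vkSum_vk3_eq_vline`;
* `μ = 1`: `Skeleton.stepB_u012R_of` with `Skeleton.vkSum_vk1_eq_vline` and the `β₆`-circle value
  `Skeleton.circleIntegral_intB1_beta6_sub_main_le`.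

This file composes them BY NAME (a kernel check that the landed pieces fit together), leaving as
hypotheses exactly the three line-to-circle bounds — `Typed.AppendixB.StepB_u009rR c′` (`μ = 2`) and its
`μ = 3`, `μ = 1` twins, stated VERBATIM as the hypotheses `h9r` of `stepB_mu3R_of_perron_shift` /
`stepB_u012R_of` — and the (B.3) inner-integral evaluation `Typed.AppendixB.StepB_u015bR c′`:

* `Skeleton.stepB_mu2R_of_u009rR` — **`StepB_u009rR c′ → StepB_mu2R c′`**;
* `Typed.Section15C.eq15_22D_of_contour_legs` —
  **`StepB_u009rR c′ → (μ = 3 line→circle) → (μ = 1 line→circle) → StepB_u015bR c′ → Eq15_22E e1ppD c′ inputs15ABchi`**.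

WHAT THIS IS NOT: a proof of the line-to-circle bounds (the shift of `∫_{(1)}` past the poles at `0` and
`β₆`/`β₇` with error `O(α₁)`, App. B p. 107 first display after (B.2)) or of `Z22:§B.u015` second line;
nor any claim about Theorems 1–2 of the manuscript or Landau–Siegel zeros.

## References
* Y. Zhang, arXiv:2211.02515v1 (2022), §15 (15.22) p. 87; Lemma 15.1 p. 86; App. B pp. 106–108.
  [cite: Zhang2022LandauSiegel, §15 (15.22) p.87; App. B p.107]
-/

noncomputable section

open Complex Real

namespace Literature.NumberTheory.LFunctions.Zhang2022.Skeleton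

open Typed.AppendixB (zetaRatio kerB vline vkSum intB2 resZero2)

section MuTwoEdge

variable (c' : ℝ)

/-- The residue of the `μ = 2` integrand at `s = 0` at rate `α₁`: for `D` large, `j ∈ {1,2,3}`, `l₁ ≥ 1`,
`‖(2πi)⁻¹∮_{|s|=α} intB2 − resZero2‖ ≤ C·α₁` — `circleIntegral_intB2_zero_sub_resZero2_le` (rate `α`)
and `α ≤ α₁ = α·𝓛^{1.1}` for `D ≥ 3`; this is the hypothesis `h10a` of `stepB_mu2_alpha1_of` verbatim.
[cite: Zhang2022LandauSiegel, App. B p.107] -/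
theorem circleIntegral_intB2_zero_sub_resZero2_le_alpha1 : ∃ C : ℝ, ForAllLarge fun D _ _ =>
    ∀ j ∈ ({1, 2, 3} : Finset ℕ), ∀ l₁ : ℕ, 1 ≤ l₁ →
      ‖(2 * π * I)⁻¹ * (∮ s in C((0 : ℂ), alpha D), intB2 c' D j l₁ s) - resZero2 c' D j‖ ≤
        C * alpha1 D := by
  obtain ⟨C, D₀, h⟩ := circleIntegral_intB2_zero_sub_resZero2_le c'
  refine ⟨max C 0, max D₀ 3, fun D _ χ hD hq hp j hj l₁ hl₁ => ?_⟩
  have a := h D χ (le_trans (le_max_left _ _) hD) hq hp j hj l₁ hl₁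
  have hD3 : (3 : ℝ) ≤ D := by exact_mod_cast le_trans (le_max_right _ _) hD
  have hℓ1 : 1 ≤ ell D := by
    rw [ell, Real.le_log_iff_exp_le (by linarith)]
    have := Real.exp_one_lt_d9; linarith
  have hα0 : 0 ≤ alpha D := by
    rw [alpha, bigP, Real.log_exp]; exact div_nonneg Real.pi_pos.le (pow_nonneg (by linarith) _)
  have hαα1 : alpha D ≤ alpha1 D := by
    rw [alpha1, log_bigT]
    have : (1 : ℝ) ≤ ell D ^ (1.1 : ℝ) := Real.one_le_rpow hℓ1 (by norm_num)
    nlinarith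
  calc _ ≤ C * alpha D := a
    _ ≤ max C 0 * alpha D := mul_le_mul_of_nonneg_right (le_max_left _ _) hα0
    _ ≤ max C 0 * alpha1 D := mul_le_mul_of_nonneg_left hαα1 (le_max_right _ _)

/-- **`StepB_u009rR c′ → StepB_mu2R c′`** (App. B p. 107, `μ = 2`: "These together complete the proof
in case μ = 2", reading `α₁ = α log T`): GIVEN the line-to-circle bound
`‖(1/2πi)∫_{(1)} intB2 − (2πi)⁻¹∮_{|s|=5α} intB2‖ ≤ C·α₁` (`StepB_u009rR`), the evaluation
`Σ_l ϰ₂(l₁l)ϱ_j(l)/l = e_{2j} + O(α₁)` follows, every other input of `stepB_mu2_alpha1_of` being a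
theorem: Perron (`stepB_u009_holds`), the two-circle split (`intB2_circle_split`), the residue at `0`
(`circleIntegral_intB2_zero_sub_resZero2_le_alpha1`, `resZero2_sub_main_le` inside), `StepB_u011a`
(`stepB_u011a_holds`) and the `β₇`-residue value (`stepB_u011bR_holds`).
[cite: Zhang2022LandauSiegel, App. B p.107] -/
theorem stepB_mu2R_of_u009rR (h9r : Typed.AppendixB.StepB_u009rR c') :
    Typed.AppendixB.StepB_mu2R c' :=
  stepB_mu2_alpha1_of c' (Typed.AppendixB.stepB_u009_holds c') h9r (intB2_circle_split c')
    (circleIntegral_intB2_zero_sub_resZero2_le_alpha1 c') (stepB_u011a_holds c')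
    (stepB_u011bR_holds c')

end MuTwoEdge

end Literature.NumberTheory.LFunctions.Zhang2022.Skeleton

namespace Literature.NumberTheory.LFunctions.Zhang2022.Typed.Section15C

open Literature.NumberTheory.LFunctions.Zhang2022.Skeleton
open Typed.AppendixB (zetaRatio kerB vline vkSum)

section ContourLegs

variable (c' : ℝ)

/-- **(15.22) in the reading of record from the three line-to-circle bounds and `Z22:§B.u015` 2nd line**
(`e1pp := AppendixB.e1ppD`; RT-05 / R-28): `StepB_u009rR c′` (`μ = 2`), the `μ = 3` and `μ = 1`
line-to-circle bounds (hypotheses `h9r` of `Skeleton.stepB_mu3R_of_perron_shift` / `Skeleton.stepB_u012R_of`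
VERBATIM) and `StepB_u015bR c′` imply `Eq15_22E e1ppD c′ inputs15ABchi` — via `stepB_mu2R_of_u009rR`,
`stepB_mu3R_of_perron_shift ∘ vkSum_vk3_eq_vline`, `stepB_u012R_of ∘ (vkSum_vk1_eq_vline,
circleIntegral_intB1_beta6_sub_main_le)`, `AppendixBVarrho.stepB_u015aR_holds` and
`eq15_22D_of_appB_legs`. [cite: Zhang2022LandauSiegel, §15 (15.22) p.87; App. B p.107] -/
theorem eq15_22D_of_contour_legs (h2r : Typed.AppendixB.StepB_u009rR c')
    (h3r : ∃ C : ℝ, ForAllLarge fun D _ _ => ∀ j ∈ ({1, 2, 3} : Finset ℕ), ∀ l₁ : ℕ, 1 ≤ l₁ →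
      l₁ ∈ Skeleton.nset (Skeleton.frakq D) → (l₁ : ℝ) < Skeleton.bigT D →
        ‖vline 1 (fun s => zetaRatio c' D j s * kerB (Skeleton.P3 D) (Skeleton.beta6 D) l₁ s) -
            (2 * π * I)⁻¹ * (∮ s in C((0 : ℂ), 5 * Skeleton.alpha D),
              zetaRatio c' D j s * kerB (Skeleton.P3 D) (Skeleton.beta6 D) l₁ s)‖ ≤ C * Skeleton.alpha1 D)
    (h1r : ∃ C : ℝ, ForAllLarge fun D _ _ => ∀ j ∈ ({1, 2, 3} : Finset ℕ), ∀ l₁ : ℕ, 1 ≤ l₁ →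
      l₁ ∈ Skeleton.nset (Skeleton.frakq D) → (l₁ : ℝ) < Skeleton.bigT D →
        ‖vline 1 (fun s => zetaRatio c' D j s * kerB (Skeleton.P1 D) (Skeleton.beta6 D) l₁ s) -
            (2 * π * I)⁻¹ * (∮ s in C((0 : ℂ), 5 * Skeleton.alpha D),
              zetaRatio c' D j s * kerB (Skeleton.P1 D) (Skeleton.beta6 D) l₁ s)‖ ≤ C * Skeleton.alpha1 D)
    (h15b : Typed.AppendixB.StepB_u015bR c') :
    Eq15_22E e1ppD c' inputs15ABchi :=
  eq15_22D_of_appB_legs c' (stepB_mu2R_of_u009rR c' h2r)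
    (stepB_mu3R_of_perron_shift c' (vkSum_vk3_eq_vline c') h3r)
    (stepB_u012R_of c' (vkSum_vk1_eq_vline c') h1r (circleIntegral_intB1_beta6_sub_main_le c'))
    (AppendixBVarrho.stepB_u015aR_holds c') h15b

end ContourLegs

end Literature.NumberTheory.LFunctions.Zhang2022.Typed.Section15C
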